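/-
Copyright (c) 2026 the pub-hodgecm-mathlib formalisation cell (harness21).  Prover seat hodgecm-mathlib-LH4-p09 (g2), req620 Track A «(D-RAM) FOUR-FRAME» squad
(heir LEAD F0P3a-plan lineage; dealer LH4-plan lineage WORD #14; MS ROAD A, Stage B brick B5₂ (i), companion — the `ρ = 0` glued stratum).  2026-09-04.
-/
import Summits.HodgeConjecture.HodgeConjecture.Theorems.F0P3cDyRamDiagonalGluedTubeCriterionTypeTwo  -- B5₂ (i): `isIntMatrix_smul_inv_fin_three`; brings ★ p855737 `formCongr_hnf_diagonal`, `det_coe_hnf`, `det_formCongr_diagonal`, `isIntMatrix_of_fin_three`, ★ `IsTypeTwoPolarisable`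
import HarnessLib

/-!
# Crux `H413`, MS ROAD A, STAGE B brick B5₂ (i), companion: «THE `ρ = 0` GLUED STRATUM `G₁(1, s)` IS TYPE-2 POLARISABLE»

Cell `hodgecm-mathlib` (D-0151), FLOOR 0, crux item H413 = `stmt-HodgeConjecture-24833`; lane `--supports stmt-HodgeConjecture-24833 --as helper` (count-neutral).  THEOREMS ONLY.
LH4-p10 (g2) MEMO v2.1 §T2.1∕§T2.3 (`r = 1`) and LH4-p04 (g2) CENSUS-B3type2 §1 (`b = 0`, `w = c − 1`): the glued stratum `G₁(1, s)` (`s` even `≥ 2`) consists of the lattices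
`latt (1 0 0; 0 1 0; y″ ζ ϖ^{1+s})` with `ζ` a unit and `|y″| = |ϖ|^s` (`x = 0` by normalisation since `b = 0`).  Unlike `ρ ≥ 1` (criterion (R) of
`F0P3cDyRamDiagonalGluedTubeCriterionTypeTwo`), EVERY such lattice is type-2 polarisable: the fixed form `D = (Ny″·P·(NζP − 1), 1 − PNζ, P)`, `P = π₀^{−s∕2}`, `π₀ = ϖσϖ`,
has Gram entries `G₀₀ = Ny″NζP²`, `G₀₁ = σ(y″)Pζ`, `G₁₀ = σ(ζ)Py″`, `G₁₁ = 1` (so `G₀₀G₁₁ = G₀₁G₁₀`), the rest in `𝔭`, and `|det G| = |ϖ|²`.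
* **`isTypeTwoPolarisable_latt_hnf_glued_zero`**.
HONEST LABEL.  Count-neutral; the census laws stay PROVER TARGETS until the MS assembly lands; `HC_CM` is proved only modulo the 7 printed citations (2 remaining named inputs:
hLiu418 = `stmt-HodgeConjecture-24832`, h413 = `stmt-HodgeConjecture-24833`) until rung 0 closes.

## References
* [Jacobowitz1962] R. Jacobowitz, *Hermitian forms over local fields*, Amer. J. Math. 84 (1962), §4, §7 (Gram matrices, modular lattices).
* [Kottwitz1986BaseChangeUnits] R. Kottwitz, *Base change for unit elements of Hecke algebras*, Compositio Math. 60 (1986), §1 pp. 240–241 (fixed-lattice counting).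
-/

set_option autoImplicit false

noncomputable section

namespace Summit.HodgeConjecture.HodgeConjecture.Cruxes.H413.F0P3cDyRamDiagonalGluedTubeCriterionTypeTwoZero

open Matrix
open Literature.NumberTheory.Automorphic Literature.NumberTheory.Automorphic.HermitianLattice Literature.NumberTheory.Automorphic.UnitaryGroup
open Literature.NumberTheory.Automorphic.UnitaryLatticeTree
open Summit.HodgeConjecture.HodgeConjecture.Cruxes.H413.F0P3cDyRamDiagonalTorusDefs
open Summit.HodgeConjecture.HodgeConjecture.Cruxes.H413.F0P3cDyRamDiagonalStableLatticeHNF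
open Summit.HodgeConjecture.HodgeConjecture.Cruxes.H413.F0P3cDyRamDiagonalGluedTubeCriterion
open Summit.HodgeConjecture.HodgeConjecture.Cruxes.H413.F0P3cDyRamDiagonalGluedTubeCriterionTypeTwo
open Summit.HodgeConjecture.HodgeConjecture.Cruxes.H413.F0P3cDyRamDiagonalStrataDefs
open scoped Valued WithZero Matrix MatrixGroups

variable {K : Type*} [Field K] [Valued K ℤᵐ⁰]

/-- **THE `ρ = 0` GLUED STRATUM IS TYPE-2 POLARISABLE** (MEMO v2.1 §T2.1∕§T2.3, `r = 1`): the normalised frame `V = (1 0 0; 0 1 0; y″ ζ ϖ^{1+s})` (`ζ` a unit, `|y″| = |ϖ|^s`,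
`s` even `≥ 2`) carries the fixed form `D = (Ny″·P·(NζP − 1), 1 − PNζ, P)`, `P = π₀^{−s∕2}`: Gram entries `G₀₀ = Ny″NζP²`, `G₀₁ = σ(y″)Pζ`, `G₁₀ = σ(ζ)Py″`, `G₁₁ = 1`
(so `G₀₀G₁₁ = G₀₁G₁₀`), the rest in `𝔭`, `|det G| = |ϖ|²`. [cite: Jacobowitz1962, §7] [cite: Kottwitz1986BaseChangeUnits, §1 pp. 240–241] -/
theorem isTypeTwoPolarisable_latt_hnf_glued_zero {σ : K →+* K} (hσ : ∀ a, σ (σ a) = a) (hvσ : ∀ a, Valued.v (σ a) = Valued.v a)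
    {ϖ : K} (hϖ0 : ϖ ≠ 0) (hϖ1 : Valued.v ϖ < 1) (s : ℕ) (hs2 : 2 ∣ s) (hs : 1 ≤ s) {ζ y'' : K} (hζ : Valued.v ζ = 1) (hy'' : Valued.v y'' = Valued.v ϖ ^ s)
    (V : GL (Fin 3) K) (hV : (V : Matrix (Fin 3) (Fin 3) K) = !![1, 0, 0; 0, 1, 0; y'', ζ, ϖ ^ (1 + s)]) :
    IsTypeTwoPolarisable σ ϖ (latt (V : Matrix (Fin 3) (Fin 3) K)) := by
  obtain ⟨t, rfl⟩ := hs2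
  have ht : 1 ≤ t := by omega
  have hvϖ : 0 < Valued.v ϖ := (Valuation.pos_iff _).2 hϖ0
  have hϖ1' : Valued.v ϖ ≤ 1 := hϖ1.le
  have hpowle : ∀ n : ℕ, Valued.v ϖ ^ n ≤ 1 := fun n => pow_le_one₀ zero_le hϖ1'
  -- `Nζ`, `π₀`, `P = π₀^{−t}`
  set Nζ : K := ζ * σ ζ with hNζ
  have hvNζ : Valued.v Nζ = 1 := by rw [hNζ, map_mul, hvσ, hζ, one_mul]
  have hσNζ : σ Nζ = Nζ := by rw [hNζ, map_mul, hσ, mul_comm]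
  set π₀ : K := ϖ * σ ϖ with hπ₀
  have hσπ₀ : σ π₀ = π₀ := by rw [hπ₀, map_mul, hσ, mul_comm]
  have hvπ₀ : Valued.v π₀ = Valued.v ϖ ^ 2 := by rw [hπ₀, map_mul, hvσ, sq]
  have hσϖ0 : σ ϖ ≠ 0 := fun h => hϖ0 (by rw [← hσ ϖ, h, map_zero])
  have hπ₀0 : π₀ ≠ 0 := mul_ne_zero hϖ0 hσϖ0
  set P : K := (π₀ ^ t)⁻¹ with hP
  set E2 : ℤᵐ⁰ := Valued.v ϖ ^ (2 * t) with hE2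
  have hE20 : E2 ≠ 0 := pow_ne_zero _ hvϖ.ne'
  have hE21 : E2 < 1 := by rw [hE2]; exact pow_lt_one₀ zero_le hϖ1 (by omega)
  have hvP : Valued.v P = E2⁻¹ := by rw [hP, map_inv₀, map_pow, hvπ₀, ← pow_mul, hE2]
  have hP0 : P ≠ 0 := by rw [hP]; exact inv_ne_zero (pow_ne_zero _ hπ₀0)
  have hσP : σ P = P := by rw [hP, map_inv₀, map_pow, hσπ₀]
  have hvPN : Valued.v (P * Nζ) = E2⁻¹ := by rw [map_mul, hvP, hvNζ, mul_one]
  have h1lt : Valued.v (1 : K) < Valued.v (P * Nζ) := by rw [map_one, hvPN]; exact one_lt_inv_iff₀.2 ⟨(zero_lt_iff.2 hE20), hE21⟩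
  have hvϖc : Valued.v (ϖ ^ (1 + 2 * t)) = E2 * Valued.v ϖ := by rw [map_pow, add_comm, pow_succ]
  have hPc : E2⁻¹ * (E2 * Valued.v ϖ) = Valued.v ϖ := by rw [← mul_assoc, inv_mul_cancel₀ hE20, one_mul]
  have hvNy : Valued.v (σ y'' * y'') = E2 * E2 := by rw [map_mul, hvσ, hy'', hE2]
  -- the form
  set D₁ : K := 1 - P * Nζ with hD₁
  set D₀ : K := σ y'' * y'' * P * (Nζ * P - 1) with hD₀
  have hvD₁ : Valued.v D₁ = E2⁻¹ := by
    rw [hD₁, sub_eq_add_neg, Valuation.map_add_eq_of_lt_right _ (by rwa [Valuation.map_neg]), Valuation.map_neg, hvPN]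
  have hvNP1 : Valued.v (Nζ * P - 1) = E2⁻¹ := by
    rw [mul_comm, sub_eq_add_neg, Valuation.map_add_eq_of_lt_left _ (by rwa [Valuation.map_neg]), hvPN]
  have hvD₀ : Valued.v D₀ = 1 := by
    rw [hD₀, map_mul, map_mul, hvNy, hvP, hvNP1, mul_assoc, mul_assoc, ← mul_assoc E2 E2⁻¹ E2⁻¹, mul_inv_cancel₀ hE20, one_mul, mul_inv_cancel₀ hE20]
  have hD₁0 : D₁ ≠ 0 := fun h => by rw [h, map_zero] at hvD₁; exact (inv_ne_zero hE20) hvD₁.symm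
  have hD₀0 : D₀ ≠ 0 := fun h => by rw [h, map_zero] at hvD₀; exact zero_ne_one hvD₀
  have hσD₁ : σ D₁ = D₁ := by rw [hD₁, map_sub, map_one, map_mul, hσP, hσNζ]
  have hσD₀ : σ D₀ = D₀ := by rw [hD₀]; simp only [map_mul, map_sub, map_one, hσ, hσP, hσNζ]; ring
  let D : Fin 3 → K := ![D₀, D₁, P]
  have hD0 : D 0 = D₀ := rfl; have hD1 : D 1 = D₁ := rfl; have hD2 : D 2 = P := rfl
  refine ⟨D, fun i => ?_, ?_⟩
  · fin_cases i; exacts [⟨hσD₀, hD₀0⟩, ⟨hσD₁, hD₁0⟩, ⟨hσP, hP0⟩]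
  -- the Gram matrix, entry by entry
  have hG := formCongr_hnf_diagonal σ D 0 y'' ζ 1 (ϖ ^ (1 + 2 * t)) V (by rw [hV])
  rw [hD0, hD1, hD2] at hG
  have e00 : D₀ + σ 0 * D₁ * 0 + σ y'' * P * y'' = σ y'' * y'' * P * (Nζ * P) := by rw [hD₀, map_zero]; ring
  have e01 : σ 0 * D₁ * 1 + σ y'' * P * ζ = σ y'' * P * ζ := by rw [map_zero]; ring
  have e10 : σ 1 * D₁ * 0 + σ ζ * P * y'' = σ ζ * P * y'' := by ring
  have e11 : σ 1 * D₁ * 1 + σ ζ * P * ζ = 1 := by rw [map_one, hD₁, hNζ]; ring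
  have hvσϖc : Valued.v (σ (ϖ ^ (1 + 2 * t))) = E2 * Valued.v ϖ := by rw [hvσ, hvϖc]
  have h00 : Valued.v (D₀ + σ 0 * D₁ * 0 + σ y'' * P * y'') ≤ 1 := by
    rw [e00]
    simp only [map_mul, hvσ, hy'', hvP, hvNζ, one_mul]
    rw [mul_assoc E2 E2 E2⁻¹, mul_inv_cancel₀ hE20, mul_one, mul_inv_cancel₀ hE20]
  have h01 : Valued.v (σ 0 * D₁ * 1 + σ y'' * P * ζ) ≤ 1 := by
    rw [e01, map_mul, map_mul, hvσ, hy'', hvP, hζ, mul_one, mul_inv_cancel₀ hE20]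
  have h10 : Valued.v (σ 1 * D₁ * 0 + σ ζ * P * y'') ≤ 1 := by
    rw [e10, map_mul, map_mul, hvσ, hζ, hvP, hy'', one_mul, inv_mul_cancel₀ hE20]
  have h11 : Valued.v (σ 1 * D₁ * 1 + σ ζ * P * ζ) ≤ 1 := by rw [e11, map_one]
  have h02 : Valued.v (σ y'' * P * ϖ ^ (1 + 2 * t)) ≤ Valued.v ϖ := by
    rw [map_mul, map_mul, hvσ, hvP, hvϖc, mul_assoc, hPc, hy'']; exact mul_le_of_le_one_left' (hpowle _)
  have h12 : Valued.v (σ ζ * P * ϖ ^ (1 + 2 * t)) ≤ Valued.v ϖ := by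
    rw [map_mul, map_mul, hvσ, hζ, one_mul, hvP, hvϖc, hPc]
  have h20 : Valued.v (σ (ϖ ^ (1 + 2 * t)) * P * y'') ≤ Valued.v ϖ := by
    rw [map_mul, map_mul, hvσϖc, hvP, mul_comm (E2 * Valued.v ϖ) E2⁻¹, hPc, hy'']; exact mul_le_of_le_one_right' (hpowle _)
  have h21 : Valued.v (σ (ϖ ^ (1 + 2 * t)) * P * ζ) ≤ Valued.v ϖ := by
    rw [map_mul, map_mul, hvσϖc, hvP, mul_comm (E2 * Valued.v ϖ) E2⁻¹, hPc, hζ, mul_one]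
  have h22 : Valued.v (σ (ϖ ^ (1 + 2 * t)) * P * ϖ ^ (1 + 2 * t)) ≤ Valued.v ϖ := by
    rw [map_mul, map_mul, hvσϖc, hvP, mul_comm (E2 * Valued.v ϖ) E2⁻¹, hPc, map_pow]; exact mul_le_of_le_one_right' (hpowle _)
  have hrk : (D₀ + σ 0 * D₁ * 0 + σ y'' * P * y'') * (σ 1 * D₁ * 1 + σ ζ * P * ζ) = (σ 0 * D₁ * 1 + σ y'' * P * ζ) * (σ 1 * D₁ * 0 + σ ζ * P * y'') := by
    rw [e00, e01, e10, e11, hNζ]; ring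
  have hGint : IsIntMatrix (formCongr σ V (Matrix.diagonal D)) := by
    rw [hG]
    exact isIntMatrix_of_fin_three h00 h01 (h02.trans hϖ1') h10 h11 (h12.trans hϖ1') (h20.trans hϖ1') (h21.trans hϖ1') (h22.trans hϖ1')
  have hdet : Valued.v (formCongr σ V (Matrix.diagonal D)).det = Valued.v ϖ ^ 2 := by
    rw [det_formCongr_diagonal, det_coe_hnf 0 y'' ζ 1 (ϖ ^ (1 + 2 * t)) V (by rw [hV]), hD0, hD1, hD2, one_mul]
    simp only [map_mul, hvD₀, hvD₁, hvP, hvϖc, hvσϖc, one_mul]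
    calc E2 * Valued.v ϖ * (E2⁻¹ * E2⁻¹) * (E2 * Valued.v ϖ) = (E2 * E2⁻¹) * (E2 * E2⁻¹) * (Valued.v ϖ * Valued.v ϖ) := by ac_rfl
      _ = Valued.v ϖ ^ 2 := by rw [mul_inv_cancel₀ hE20, one_mul, one_mul, sq]
  have hdet' := hdet
  rw [hG] at hdet'
  have hinv : IsIntMatrix (ϖ • (formCongr σ V (Matrix.diagonal D))⁻¹) := by
    rw [hG]
    exact isIntMatrix_smul_inv_fin_three hϖ0 hϖ1' hdet' h00 h01 h10 h11 h02 h12 h20 h21 h22 hrk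
  exact (isVertexLattice_latt_iff_of_v σ hvσ hϖ0 (Matrix.diagonal D) 2 V).2 ⟨hGint, hinv, hdet⟩

end Summit.HodgeConjecture.HodgeConjecture.Cruxes.H413.F0P3cDyRamDiagonalGluedTubeCriterionTypeTwoZero

end
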